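import Summits.SmoothPoincare4.SmoothPoincare4.Theorems.ConvexBisectionAcyclicBisectionExistsSeamShadowInverse
import Summits.SmoothPoincare4.SmoothPoincare4.Theorems.ConvexBisectionAcyclicBisectionExistsPageRotationFlow
import Mathlib.Analysis.SpecialFunctions.Complex.Log
import HarnessLib

/-!
# Seam transport, ST3: the shadow of a seam-pushed page knot is an automorphic image of its shadow
# — ALL unit directions, the critical ones by a small page rotation
(wave 4, sub-node ST3 `node_ST3_shadowTransport` of node T3c-2 `node_seam_transport` of stub
`stub_steinRealisation` = NF6, line `modp-braid-orbits` r11, crux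
`ConvexBisection.AcyclicBisectionExists`, item stmt-SmoothPoincare4-10508; registered sub-goal
`helper_seam_shadowTransport` = the design's `node_ST3_shadowTransport` with the page clause inlined)

`…SeamShadowInverse.lean` (ST3b) gives, for every NON-CRITICAL unit direction `c'`, an automorphism
`A_{c'}` of `ℤ^{2g}` with `shadow (push K) = A_{c'} (shadow K)` for all page knots `K ⊂ page g c'`.
Here an ARBITRARY unit direction `c` (possibly `pageDir |l| k`, where the page contains the core
`K_k`) is reduced to a non-critical neighbour: the critical directions met by the arc
`c · e^{it}`, `0 < t ≤ 1`, are finitely many (`exists_noncritical_arc`: at most one `t` per letter,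
by `2π`-periodicity of `exp`), so for a small `ε > 0` all of `c e^{it}`, `0 < t ≤ ε`, are
non-critical; the rigid page rotation `R` of `helper_rotFlow_page` (constant profile `1`) carries a
page knot `K ⊂ page g c ∖ cores` through the core-free pages `page g (c e^{it})`, and the seam map
`F` of `…SeamFibreMap.lean` (continuous on `∂ Base g ∖ cores`) reads `t ↦ F ∘ R_{tε} ∘ K` as a free
homotopy in `Base g` from the push of `K` to the push of `R_ε ∘ K ⊂ page g (c e^{iε})`; hence
`shadow (push K) = shadow (push (R_ε ∘ K)) = A_{c e^{iε}} (shadow (R_ε ∘ K)) = A_{c e^{iε}} (shadow K)`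
(`shadow_eq_of_family`, `shadow_comp_ambientIsotopy`): `A_c := A_{c e^{iε}}` works uniformly.

Everything is proved; no named facts, no `sorry`, no new definitions.  References: R. İ. Baykur,
*Kähler decomposition of 4-manifolds*, AGT 6 (2006), proof of Thm. 5.1 [Baykur2006]; A. Hatcher,
*Algebraic Topology* (2002), Thm. 2A.1 [HatcherAT2002].
-/

noncomputable section

set_option linter.dupNamespace false

open scoped Manifold ContDiff Topology

namespace Summit.SmoothPoincare4.SmoothPoincare4.Theorems.AcyclicBisectionExists.ModpBraidOrbits

open Set Function Filter Metric Topology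
open Literature.Topology.FourManifolds Literature.Topology.FourManifolds.HandleAttachingMap
  Literature.Topology.FourManifolds.LefschetzBase

/-! ## §1 A small arc of non-critical directions -/

/-- On the arc `c e^{it}`, `t ∈ (0, 1]`, each value is taken at most once (`2π > 1`). [folklore] -/
theorem eq_of_exp_mul_eq {c : ℂ} (hc : c ≠ 0) {t t' : ℝ} (ht : t ∈ Ioc (0 : ℝ) 1) (ht' : t' ∈ Ioc (0 : ℝ) 1)
    (h : Complex.exp (Complex.I * t) * c = Complex.exp (Complex.I * t') * c) : t = t' := by
  have h1 : Complex.exp (Complex.I * t) = Complex.exp (Complex.I * t') := mul_right_cancel₀ hc h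
  obtain ⟨n, hn⟩ := Complex.exp_eq_exp_iff_exists_int.1 h1
  have h2 : (t : ℝ) = t' + n * (2 * Real.pi) := by
    have h3 := congrArg Complex.im hn
    simp [Complex.mul_im] at h3
    linarith
  have hn0 : n = 0 := by
    by_contra hne
    have h4 : (1 : ℝ) ≤ |(n : ℝ)| := by
      rw [← Int.cast_abs]; exact_mod_cast Int.one_le_abs hne
    have h5 : |t - t'| < 1 := by
      rw [abs_lt]; constructor <;> linarith [ht.1, ht.2, ht'.1, ht'.2]
    have h6 : |t - t'| = |(n : ℝ)| * (2 * Real.pi) := by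
      rw [h2, add_sub_cancel_left, abs_mul, abs_of_pos (by positivity : (0 : ℝ) < 2 * Real.pi)]
    have h7 : (2 * Real.pi : ℝ) ≤ |(n : ℝ)| * (2 * Real.pi) := by nlinarith [Real.pi_pos]
    linarith [Real.pi_gt_three]
  rw [hn0] at h2
  simpa using h2

/-- **A small arc of non-critical directions**: for finitely many `d k` there is `ε > 0` such that
`c e^{it} ≠ d k` for all `0 < t ≤ ε` and all `k`. [folklore] -/
theorem exists_noncritical_arc {n : ℕ} {c : ℂ} (hc : c ≠ 0) (d : Fin n → ℂ) :
    ∃ ε : ℝ, 0 < ε ∧ ε ≤ 1 ∧ ∀ t ∈ Ioc (0 : ℝ) ε, ∀ k, Complex.exp (Complex.I * t) * c ≠ d k := by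
  classical
  -- the (unique, if any) parameter at which the arc meets `d k`, else `1`
  let f : Fin n → ℝ := fun k =>
    if hk : ∃ t ∈ Ioc (0 : ℝ) 1, Complex.exp (Complex.I * t) * c = d k then Classical.choose hk else 1
  have hf : ∀ k, f k ∈ Ioc (0 : ℝ) 1 := fun k => by
    by_cases hk : ∃ t ∈ Ioc (0 : ℝ) 1, Complex.exp (Complex.I * t) * c = d k
    · simp only [f, dif_pos hk]; exact (Classical.choose_spec hk).1
    · simp only [f, dif_neg hk]; exact ⟨one_pos, le_rfl⟩
  have hfu : ∀ k, ∀ t ∈ Ioc (0 : ℝ) 1, Complex.exp (Complex.I * t) * c = d k → t = f k := by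
    intro k t ht he
    have hk : ∃ t ∈ Ioc (0 : ℝ) 1, Complex.exp (Complex.I * t) * c = d k := ⟨t, ht, he⟩
    have hspec := Classical.choose_spec hk
    have e : f k = Classical.choose hk := by simp only [f, dif_pos hk]
    rw [e]
    exact eq_of_exp_mul_eq hc ht hspec.1 (he.trans hspec.2.symm)
  rcases isEmpty_or_nonempty (Fin n) with hι | hι
  · exact ⟨1, one_pos, le_rfl, fun t _ k => (IsEmpty.false k).elim⟩
  · obtain ⟨k₀, hk₀⟩ := Finite.exists_min f
    refine ⟨f k₀ / 2, by linarith [(hf k₀).1], by linarith [(hf k₀).2], fun t ht k he => ?_⟩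
    have ht1 : t ∈ Ioc (0 : ℝ) 1 := ⟨ht.1, ht.2.trans (by linarith [(hf k₀).1, (hf k₀).2])⟩
    have e := hfu k t ht1 he
    have h1 := hk₀ k
    linarith [ht.2, (hf k₀).1]

/-! ## §2 The sub-node -/

section Transport

variable {g : ℕ} {l : List ((Fin g ⊕ Fin g → ℤ) × Bool)}
  {h : Fin l.length → HandleAttachingMap 3 2 (Base g)}
  {X : Type} [TopologicalSpace X] [T2Space X] [SecondCountableTopology X] [CompactSpace X]
  [ChartedSpace (EuclideanHalfSpace 4) X] [IsManifold (𝓡∂ 4) ∞ X]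
  (D : MultiAttachmentData h (𝓡∂ 4) X) (bX : BoundaryData (𝓡∂ 4) X (𝓡 3))
  (Ψ : bX.carrier ≃ₘ⟮𝓡 3, 𝓡 3⟯ (bBase g).carrier)

/-- **ST3 — the shadow of the seam push of a page knot is `A_c` of its shadow, for ONE automorphism
`A_c` of `ℤ^{2g}` depending on the direction only — every unit direction, the critical ones
included.** [cite: Baykur2006, Thm. 5.1 (proof, p. 13)] -/
theorem seam_shadowTransport (hlink : IsLefschetzLink g l h)
    (hpage : ∀ (y : bX.carrier) (a : ↥(coresComplement h)), bX.incl y = D.jA a →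
      ∃ c : ℝ, 0 < c ∧ w g ((bBase g).incl (Ψ y)).1 = (c : ℂ) * w g (a : Base g).1)
    {c : ℂ} (hc : ‖c‖ = 1) :
    ∃ A : (Fin g ⊕ Fin g → ℤ) ≃ₗ[ℤ] (Fin g ⊕ Fin g → ℤ),
      ∀ (K : sphere (0 : EuclideanSpace ℝ (Fin 2)) 1 → Base g) (hKc : Continuous K)
        (hK : ∀ θ, K θ ∈ coresComplement h) (_ : ∀ θ, K θ ∈ page g c)
        (z : sphere (0 : EuclideanSpace ℝ (Fin 2)) 1 → bX.carrier)
        (_ : ∀ θ, bX.incl (z θ) = D.jA ⟨K θ, hK θ⟩)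
        (hGz : Continuous fun θ => ((bBase g).incl (Ψ (z θ)) : Base g)),
        shadow g (fun θ => ((bBase g).incl (Ψ (z θ)) : Base g)) hGz = A (shadow g K hKc) := by
  have hc0 : c ≠ 0 := fun h0 => by rw [h0, norm_zero] at hc; exact zero_ne_one hc
  -- a small arc of non-critical directions and the non-critical neighbour `c' = e^{iε} c`
  obtain ⟨ε, hε, hε1, harc⟩ := exists_noncritical_arc hc0 fun k : Fin l.length => pageDir l.length k
  have hunit : ∀ t : ℝ, ‖Complex.exp (Complex.I * t) * c‖ = 1 := fun t => by
    rw [norm_mul, hc, mul_one, show Complex.I * t = (t : ℂ) * Complex.I by ring, Complex.norm_exp_ofReal_mul_I]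
  obtain ⟨A, hA⟩ := seam_shadowEquiv D bX Ψ hlink hpage (hunit ε) (harc ε ⟨hε, le_rfl⟩)
  -- the seam map (for the homotopy) and the rigid page rotation
  obtain ⟨F, -, -, hF, -, -, -, -, -, -, hnode, -, -, -⟩ := seam_fibreMap_of_link D bX Ψ hlink hpage
  obtain ⟨R, θf, -, -, -, hRθ, hρθ, -, -, -, hrot⟩ := helper_rotFlow_page g (fun _ => (1 : ℝ)) contDiff_const
  have hrot' : ∀ (x : Base g) (c : ℂ) (t : ℝ), x ∈ page g c →
      R.toFun t x ∈ page g (Complex.exp (Complex.I * t) * c) := fun x c t hx => by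
    have h1 := hrot 1 (fun _ => rfl) x c t hx
    simpa using h1
  have hbdry : ∀ {x : Base g}, x ∈ (𝓡∂ 4).boundary (Base g) ↔ rho g x.1 = 1 / 4 := fun {x} =>
    RegularSublevel.mem_boundary_iff (isRegularLevel_rho g) x
  refine ⟨A, fun K hKc hK hKp z hz hGz => ?_⟩
  -- the rotated knot `K_ε ⊂ page g c'`, off the cores, and its lifts
  have hKε : ∀ θ, R.toFun ε (K θ) ∈ page g (Complex.exp (Complex.I * ε) * c) := fun θ => hrot' _ _ _ (hKp θ)
  have hfreeε : ∀ a ∈ page g (Complex.exp (Complex.I * ε) * c), a ∈ coresComplement h := fun a ha =>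
    mem_coresComplement_of_ray hlink (hunit ε) (harc ε ⟨hε, le_rfl⟩) ⟨1 / 2, by norm_num, by
      rw [ha.2]; push_cast; ring⟩
  have hKεc : Continuous fun θ => R.toFun ε (K θ) := (R.contMDiff_toFun ε).continuous.comp hKc
  obtain ⟨lam, hlam⟩ := exists_pageLift D bX (hunit ε) hfreeε
  have hPc : Continuous fun θ => ((bBase g).incl (Ψ (lam ⟨R.toFun ε (K θ), hKε θ⟩)) : Base g) :=
    (continuous_pagePush D bX Ψ hfreeε hlam).comp (hKεc.subtype_mk hKε)
  have hPA : shadow g (fun θ => ((bBase g).incl (Ψ (lam ⟨R.toFun ε (K θ), hKε θ⟩)) : Base g)) hPc =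
      A (shadow g K hKc) := by
    rw [hA _ hKεc (fun θ => hfreeε _ (hKε θ)) hKε _ (fun θ => hlam ⟨_, hKε θ⟩) hPc]
    congr 1
    exact shadow_comp_ambientIsotopy R ε hKc hKεc
  -- the homotopy `t ↦ F (R_{tε} (K θ))`, `t ∈ [0, 1]`, inside `∂B ∖ cores`
  have hU : ∀ t ∈ Icc (0 : ℝ) 1, ∀ θ,
      R.toFun (t * ε) (K θ) ∈ {a : Base g | a ∈ (𝓡∂ 4).boundary (Base g) ∧ a ∈ coresComplement h} := by
    intro t ht θ
    refine ⟨hbdry.2 ?_, ?_⟩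
    · rw [hRθ, hρθ]; exact rho_eq_of_mem_page g hc (hKp θ)
    · rcases eq_or_lt_of_le ht.1 with h0 | h0
      · rw [← h0, zero_mul, R.map_zero]; exact hK θ
      · have htε : t * ε ∈ Ioc (0 : ℝ) ε := ⟨mul_pos h0 hε, by nlinarith [ht.2]⟩
        exact mem_coresComplement_of_ray hlink (hunit (t * ε)) (harc _ htε)
          ⟨1 / 2, by norm_num, by rw [(hrot' _ _ _ (hKp θ)).2]; push_cast; ring⟩
  have hfam := shadow_eq_of_family (K₀ := fun θ => ((bBase g).incl (Ψ (z θ)) : Base g))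
    (K₁ := fun θ => ((bBase g).incl (Ψ (lam ⟨R.toFun ε (K θ), hKε θ⟩)) : Base g))
    (fun t θ => F (R.toFun (t * ε) (K θ))) ?_ hGz hPc (fun θ => ?_) (fun θ => ?_)
  · rw [hfam, hPA]
  · have hin : Continuous fun p : ℝ × sphere (0 : EuclideanSpace ℝ (Fin 2)) 1 =>
        R.toFun (p.1 * ε) (K p.2) :=
      R.contMDiff.continuous.comp ((continuous_fst.mul continuous_const).prodMk (hKc.comp continuous_snd))
    exact hF.comp hin.continuousOn fun p hp => hU p.1 hp.1 p.2
  · show F (R.toFun (0 * ε) (K θ)) = (bBase g).incl (Ψ (z θ))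
    rw [zero_mul, R.map_zero]
    exact hnode (K θ) (hK θ) (z θ) (hz θ)
  · show F (R.toFun (1 * ε) (K θ)) = (bBase g).incl (Ψ (lam ⟨R.toFun ε (K θ), hKε θ⟩))
    rw [one_mul]
    exact hnode _ (hfreeε _ (hKε θ)) _ (hlam ⟨_, hKε θ⟩)

/-- **Sub-goal `helper_seam_shadowTransport` of stub `stub_steinRealisation`** (NF6 ▸ T3 ▸ T3c-2 ▸ ST3
= `node_ST3_shadowTransport` of the design file `T3c2_SeamTransport_Design.lean`, page clause
inlined; wave 4, lead c5): for a fibred model (Lefschetz link `h` of word `l`, data `D`, boundary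
datum `bX`, seam `Ψ`, page clause) and EVERY unit direction `c`, there is an automorphism
`A : ℤ^{2g} ≃ₗ[ℤ] ℤ^{2g}` with `shadow (θ ↦ (bBase g).incl (Ψ (z θ))) = A (shadow K)` for every page loop
`K ⊂ page g c` off the cores with lifts `z` (`bX.incl (z θ) = D.jA (K θ)`).
[cite: Baykur2006, Thm. 5.1 (proof, p. 13)] -/
theorem helper_seam_shadowTransport : ∀ (g : ℕ) (l : List ((Fin g ⊕ Fin g → ℤ) × Bool)) (h : Fin l.length → Literature.Topology.FourManifolds.HandleAttachingMap 3 2 (Literature.Topology.FourManifolds.LefschetzBase.Base g)) (X : Type) [TopologicalSpace X] [T2Space X] [SecondCountableTopology X] [CompactSpace X] [ChartedSpace (EuclideanHalfSpace 4) X] [IsManifold (𝓡∂ 4) ∞ X] (D : Literature.Topology.FourManifolds.HandleAttachingMap.MultiAttachmentData h (𝓡∂ 4) X) (bX : Literature.Topology.FourManifolds.BoundaryData (𝓡∂ 4) X (𝓡 3)) (Ψ : bX.carrier ≃ₘ⟮𝓡 3, 𝓡 3⟯ (Literature.Topology.FourManifolds.LefschetzBase.bBase g).carrier), Literature.Topology.FourManifolds.LefschetzBase.IsLefschetzLink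 g l h → (∀ (y : bX.carrier) (a : ↥(Literature.Topology.FourManifolds.HandleAttachingMap.coresComplement h)), bX.incl y = D.jA a → ∃ c : ℝ, 0 < c ∧ Literature.Topology.FourManifolds.LefschetzBase.w g ((Literature.Topology.FourManifolds.LefschetzBase.bBase g).incl (Ψ y)).1 = (c : ℂ) * Literature.Topology.FourManifolds.LefschetzBase.w g (a : Literature.Topology.FourManifolds.LefschetzBase.Base g).1) → ∀ (c : ℂ), ‖c‖ = 1 → ∃ A : (Fin g ⊕ Fin g → ℤ) ≃ₗ[ℤ] (Fin g ⊕ Fin g → ℤ), ∀ (K : Metric.sphere (0 : EuclideanSpace ℝ (Fin 2)) 1 → Literature.Topology.FourManifolds.LefschetzBase.Base g) (hKc : Continuous K) (hK : ∀ θ, K θ ∈ Literature.Topology.FourManifolds.HandleAttachingMap.coresComplement h), (∀ θ, K θ ∈ Literature.Topology.FourManifolds.LefschetzBase.page g c) → ∀ (z : Metric.sphere (0 : EuclideanSpace ℝ (Fin 2)) 1 → bX.carrier), (∀ θ, bX.incl (z θ) = D.jA ⟨K θ, hK θ⟩) → ∀ (hGz : Continuous fun θ => ((Literature.Topology.FourManifolds.LefschetzBase.bBase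 g).incl (Ψ (z θ)) : Literature.Topology.FourManifolds.LefschetzBase.Base g)), Literature.Topology.FourManifolds.LefschetzBase.shadow g (fun θ => ((Literature.Topology.FourManifolds.LefschetzBase.bBase g).incl (Ψ (z θ)) : Literature.Topology.FourManifolds.LefschetzBase.Base g)) hGz = A (Literature.Topology.FourManifolds.LefschetzBase.shadow g K hKc) :=
  fun _ _ _ _ _ _ _ _ _ _ D bX Ψ hlink hpage _ hc => seam_shadowTransport D bX Ψ hlink hpage hc

end Transport

end Summit.SmoothPoincare4.SmoothPoincare4.Theorems.AcyclicBisectionExists.ModpBraidOrbits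

end
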